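import Mathlib
import HarnessLib
import Literature.Probability.MarkovChains.DistinguishingStatistic
import Literature.Probability.MarkovChains.ContractionSpectralGap
import Literature.Probability.LatticeModels.StrassenHolleyCoupling

/-!
# Strassen's theorem for stochastic domination by increasing functions (Levin–Peres–Wilmer Theorem 22.6) and monotone row couplings (Proposition 22.7 (i) ⟹ (iii))

HONEST FRAMING: exact (Metropolis-corrected) sampling algorithms for lattice gauge theory; figures
of merit are autocorrelation/cost numbers at stated couplings and volumes; no continuum-physics claim.

Conventions of `DistinguishingStatistic.lean` (`lawMean μ f = E_μ f`), `ContractionSpectralGap.lean`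
(`IsCoupling μ ν q`: `q ≥ 0` with marginals `μ` (first) and `ν` (second)) and — the engine of this
file — `Literature/Probability/LatticeModels/StrassenHolleyCoupling.lean`, which proves STRASSEN'S
THEOREM on a finite preorder in the up-set form "`Σ_{z∈U} μ ≤ Σ_{z∈U} ν` for every up-set `U` ⟺ a
monotone coupling exists" (`Literature.Probability.LatticeModels.exists_monotoneCoupling_of_upperSets_le`,
by LP duality).  The book's Chapter 22 defines `μ ⪯ ν` through increasing FUNCTIONS
(`E_μ f ≤ E_ν f` for all increasing `f`; `StochasticDomination.lean` names this `StochDom μ ν` — the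
hypotheses below are that predicate written out, so the theorems apply to it by unfolding).  Source:
D. A. Levin, Y. Peres (with E. L. Wilmer), *Markov Chains and Mixing Times*, 2nd ed., AMS 2017
[LevinPeres2017], §22.2.2 Theorem 22.6 (p. 307; proof of necessity in §22.8 via max-flow/min-cut) and
§22.3 Proposition 22.7 (p. 308); read from the author-hosted copy.  Everything is PROVED (0 named facts).

* `upperSets_le_of_forall_monotone` — domination on increasing functions gives domination on up-sets
  (test the indicator of the up-set) [cite: LevinPeres2017, §22.2.2 (definition of `μ ⪯ ν`) with
  §22.8 (proof of Thm 22.6: increasing events)];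
* **THEOREM 22.6 (Strassen), necessity** `LevinPeres2017_thm_22_6_necessity` — if `E_μ f ≤ E_ν f` for
  all increasing `f` (probability vectors `μ, ν ≥ 0`), there is a coupling `(X, Y)` of `μ` and `ν` with
  `X ⪯ Y` a.s. [cite: LevinPeres2017, §22.2.2 Thm 22.6 (necessity, proved in §22.8)]; with the easy
  half, the **`iff`** `LevinPeres2017_thm_22_6` [cite: LevinPeres2017, §22.2.2 Thm 22.6];
* **PROPOSITION 22.7, (i) ⟹ (iii)** `LevinPeres2017_prop_22_7_couplings` — a monotone transition
  matrix admits, for every `x ⪯ y`, a coupling of `P(x,·)` with `P(y,·)` supported on `{X ⪯ Y}`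
  [cite: LevinPeres2017, §22.3 Prop. 22.7 (i) ⟹ (ii) ⟹ (iii) ("Theorem 22.6 yields the required
  coupling")];
* **Holley's inequality, functional form** `Holley1974_cor_11` — on a finite distributive lattice,
  Holley's condition `μ₁(a)μ₂(b) ≤ μ₁(a∧b)μ₂(a∨b)` (equal masses) gives `E_{μ₁} f ≤ E_{μ₂} f` for
  increasing `f` [cite: Holley1974, Thm. (6) with Cor. (11)] (R. Holley, *Remarks on the FKG
  inequalities*, Comm. Math. Phys. 36 (1974) 227–231, read: the open journal scan through
  `lit read doi:10.1007/bf01645980`).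

Context (cell pub-lqcd, venture LatticeQCDFlow): monotone couplings of the rows are what a grand
coupling / coupling-from-the-past implementation of a monotone heat-bath chain realises; this file
closes the `TODO(general form)` left in `StochasticDomination.lean` for the necessity half of
Theorem 22.6 by pointing it at the tree's Strassen theorem.
-/

namespace Literature.Probability.MarkovChains

open Finset

variable {X : Type*} [Fintype X] [DecidableEq X] [Preorder X]

omit [Fintype X] in
/-- The real indicator of an up-set is increasing. [folklore] -/
private theorem monotone_ite_mem_of_isUpperSet (U : Finset X) (hU : IsUpperSet (U : Set X)) :
    Monotone (fun z => if z ∈ U then (1 : ℝ) else 0) := by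
  intro a b hab
  by_cases ha : a ∈ U
  · have hb : b ∈ U := hU hab ha
    simp [ha, hb]
  · by_cases hb : b ∈ U <;> simp [ha, hb]

/-- Domination on increasing functions implies domination on up-sets:
`(∀ f increasing, E_μ f ≤ E_ν f) ⟹ μ(U) ≤ ν(U)` for every up-set `U`.
[cite: LevinPeres2017, §22.2.2 (definition of `μ ⪯ ν`, p. 307) with §22.8 (increasing events in the
proof of Thm 22.6)] -/
theorem upperSets_le_of_forall_monotone {μ ν : X → ℝ}
    (h : ∀ f : X → ℝ, Monotone f → lawMean μ f ≤ lawMean ν f) (U : Finset X)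
    (hU : IsUpperSet (U : Set X)) : ∑ z ∈ U, μ z ≤ ∑ z ∈ U, ν z := by
  have := h _ (monotone_ite_mem_of_isUpperSet U hU)
  simpa only [lawMean, mul_ite, mul_one, mul_zero, sum_ite_mem, univ_inter] using this

/-- **THEOREM 22.6 (Strassen) — necessity.**  On a finite (pre)ordered set, if the probability vectors
`μ, ν ≥ 0` satisfy `E_μ f ≤ E_ν f` for every increasing `f` (`μ ⪯ ν`), then there is a coupling
`(X, Y)` — a joint law `q` with marginals `μ`, `ν` — with `P{X ⪯ Y} = 1` (`q(a,b) > 0 ⟹ a ≤ b`).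
The coupling is the tree's Strassen theorem (`LatticeModels.StrassenHolleyCoupling`, LP duality)
applied to the up-set domination obtained from the increasing-function domination.
[cite: LevinPeres2017, §22.2.2 Thm 22.6 (necessity; the book's proof is §22.8, max-flow/min-cut)] -/
theorem LevinPeres2017_thm_22_6_necessity {μ ν : X → ℝ} (hμ : ∀ x, 0 ≤ μ x) (hν : ∀ x, 0 ≤ ν x)
    (hμ1 : ∑ x, μ x = 1) (hν1 : ∑ x, ν x = 1)
    (h : ∀ f : X → ℝ, Monotone f → lawMean μ f ≤ lawMean ν f) :
    ∃ q : X → X → ℝ, IsCoupling μ ν q ∧ ∀ a b, 0 < q a b → a ≤ b := by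
  obtain ⟨q, hq0, hsupp, hqμ, hqν⟩ :=
    Literature.Probability.LatticeModels.exists_monotoneCoupling_of_upperSets_le μ ν hμ hν
      (by rw [hμ1, hν1]) (upperSets_le_of_forall_monotone h)
  exact ⟨q, ⟨hq0, hqμ, hqν⟩, fun a b hab => hsupp a b hab.ne'⟩

/-- **THEOREM 22.6 (Strassen).**  For probability vectors `μ, ν ≥ 0` on a finite (pre)ordered set:
`μ ⪯ ν` (i.e. `E_μ f ≤ E_ν f` for all increasing `f`) if and only if there is a coupling `(X, Y)` of
`μ` and `ν` with `X ⪯ Y` almost surely. [cite: LevinPeres2017, §22.2.2 Thm 22.6] -/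
theorem LevinPeres2017_thm_22_6 {μ ν : X → ℝ} (hμ : ∀ x, 0 ≤ μ x) (hν : ∀ x, 0 ≤ ν x)
    (hμ1 : ∑ x, μ x = 1) (hν1 : ∑ x, ν x = 1) :
    (∀ f : X → ℝ, Monotone f → lawMean μ f ≤ lawMean ν f) ↔
      ∃ q : X → X → ℝ, IsCoupling μ ν q ∧ ∀ a b, 0 < q a b → a ≤ b := by
  refine ⟨LevinPeres2017_thm_22_6_necessity hμ hν hμ1 hν1, ?_⟩
  rintro ⟨q, ⟨hq0, hqμ, hqν⟩, hle⟩ f hf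
  -- sufficiency (p. 308): `E_μ f = E f(X) ≤ E f(Y) = E_ν f`
  exact Literature.Probability.LatticeModels.sum_mul_le_sum_mul_of_monotoneCoupling μ ν f q hq0
    (fun a b hab => hle a b (lt_of_le_of_ne (hq0 a b) (Ne.symm hab))) hqμ hqν hf

/-- **PROPOSITION 22.7, (i) ⟹ (iii).**  If the transition matrix `P` is monotone (`Pf` increasing for
every increasing `f`), then for every pair of comparable states `x ⪯ y` there is a coupling `(X, Y)` of
`P(x,·)` with `P(y,·)` satisfying `X ⪯ Y`: indeed `δ_x P ⪯ δ_y P`, and Theorem 22.6 yields the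
coupling. [cite: LevinPeres2017, §22.3 Prop. 22.7, proof of (i) ⟹ (ii) ⟹ (iii)] -/
theorem LevinPeres2017_prop_22_7_couplings {P : X → X → ℝ} (hP : IsRowStochastic P)
    (hmono : ∀ f : X → ℝ, Monotone f → Monotone (fun x => lawMean (P x) f)) {x y : X} (hxy : x ≤ y) :
    ∃ q : X → X → ℝ, IsCoupling (P x) (P y) q ∧ ∀ a b, 0 < q a b → a ≤ b :=
  LevinPeres2017_thm_22_6_necessity (hP.1 x) (hP.1 y) (hP.2 x) (hP.2 y)
    (fun f hf => hmono f hf hxy)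

/-- **HOLLEY'S INEQUALITY (functional form).**  On a finite distributive lattice let `μ₁, μ₂ ≥ 0`
have equal total mass and satisfy Holley's condition `μ₁(a) μ₂(b) ≤ μ₁(a ∧ b) μ₂(a ∨ b)`.  Then
`μ₁ ⪯ μ₂`: `E_{μ₁} f ≤ E_{μ₂} f` for every increasing `f` — Holley's coupling theorem followed by his
one-line corollary (the tree's `LatticeModels.exists_monotoneCoupling_of_holley`, then transport of
`f` along the monotone coupling).  Printed for strictly positive probability measures with the indices
exchanged (`μ₁` above `μ₂`). [cite: Holley1974, Thm. (6) with Cor. (11)] -/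
theorem Holley1974_cor_11 {Y : Type*} [Fintype Y] [DecidableEq Y] [DistribLattice Y] {μ₁ μ₂ : Y → ℝ}
    (h₁ : ∀ a, 0 ≤ μ₁ a) (h₂ : ∀ a, 0 ≤ μ₂ a) (hmass : ∑ a, μ₁ a = ∑ a, μ₂ a)
    (hH : ∀ a b, μ₁ a * μ₂ b ≤ μ₁ (a ⊓ b) * μ₂ (a ⊔ b)) {f : Y → ℝ} (hf : Monotone f) :
    lawMean μ₁ f ≤ lawMean μ₂ f := by
  obtain ⟨q, hq0, hsupp, hq₁, hq₂⟩ :=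
    Literature.Probability.LatticeModels.exists_monotoneCoupling_of_holley μ₁ μ₂ h₁ h₂ hmass hH
  exact Literature.Probability.LatticeModels.sum_mul_le_sum_mul_of_monotoneCoupling μ₁ μ₂ f q hq0
    hsupp hq₁ hq₂ hf

end Literature.Probability.MarkovChains
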